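import Summits.CriticalPhenomena.PercolationContinuityZ3.Theorems.PercNearOneGluingNoHeavyPcintChordDiagramLaw
import HarnessLib

/-!
# CriticalPhenomena/PercolationContinuityZ3 — Theorems/PercNearOneGluingNoHeavyPcintSubleadingChordLaw.lean: the ONE-DEFECT LAW for the SUB-LEADING polygon coefficient (STRUCTURE P22) — typed, closed form in the Touchard–Riordan numbers, instances `m = 2, 3, 4, 5` PROVED

Lane prim-pcint, STRUCTURE rule «numerics ⇒ structure ⇒ conjecture» (prim-pcint-2 GEN 21; pre-registered as P22, 2026-08-27 01:20Z, sha256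
342f519d…, prediction file run/shared/lean/prim/pcint/predictions/P22-subleading-polygon-coefficient-one-defect-law-2026-08-27.md; item P22c
HIT at zero tolerance the same hour by a third implementation).  Sequel of …PcintChordDiagramLaw (law C5-L1: the LEADING coefficient of the
rooted oriented `2m`-gon count `closingCount d (2m) = 2·2m·p_2m(ℤ^d)` in `σ = 2d` is the connected-chord-diagram number `a(m)`, proved for all `m`
in …PcintPolygonChordLaw).

THE LAW (C5-L4).  Write `A'_m := [σ^{m−1}] closingCount d (2m)` for the SUB-LEADING coefficient (`−2, −21, −262, −3755, −60795, −1097852` for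
`m = 2..7`, read off the exact polynomials of the lane).  Then
  **`A'_m = b(m) − m(m−1)·a(m)`**,  `b(m) = 0, 3, 62, 1205, 24105, 507892, 11369212, 271232325, 6899770620, …`,
where `b(m)` has three equivalent descriptions (L4b) and a closed form (L4c):
* (L4a, mechanism) `fullClosingCount (m−1) (2m) = (m−1)!·2^{m−1}·b(m)`: a closing word of length `2m` spanning `m − 1` axes uses ONE axis four
  times (twice each sign) and the others twice; modulo axis labels and orientations it is a ONE-DEFECT STRUCTURE (`m−2` chords and a signed
  4-block on the `2m` linearly ordered steps), and the word is self-avoiding iff the structure is irreducible (no proper block of consecutive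
  steps cancels);
* (L4b) `b(m)` = the number of EDGES of the SWITCH GRAPH on connected chord diagrams with `m` chords (`D ~ D'` iff they differ by re-pairing the
  four endpoints of two chords) = `Pa(m) + Ne(m) + PN(m)`, where `Pa`/`Ne` = total number of parallel/nested chord pairs over the connected
  diagrams with `m` chords and `PN(m)` = number of (connected diagram, crossing pair) such that no interval is crossed by exactly that pair;
* (L4c, closed form) with `U(x) = Σ a(i+1)x^i`, `A'(x) = Σ (i+1)a(i+1)x^i`, `H_j(x) = Σ_i C(2i−1, j)·a(i)·x^i`:
  **`b(m) = [x^{m−2}] ( 5·A'³ + U³·A'·(9H₃ − 7) + U⁴·(3H₄ + 2) )`**  (`oneDefect` below; `PN = [x^{m−2}](U⁴H₄ + 2U³A'H₃)`,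
  `Pa = [x^{m−2}](2A'³ + 3U³A'(H₃ − 1) + U⁴(1+H₄))`, `Ne = [x^{m−2}](3A'³ + 4U³A'(H₃−1) + U⁴(1+H₄))`).
  MECHANISM of (L4c): delete the four defect letters; what remains is an ARBITRARY chord diagram, i.e. a plane forest of arches (arch = connected
  component with its `2k−1` inner gaps filled recursively); the cancelling blocks of the word are exactly the runs of consecutive arches in one gap
  together with adjacent defect letters, so self-avoidance forces single-arch gaps, odd/non-cancelling defect content in every arch and defect
  letters in empty gaps only; `U = 1/(1 − Σ(2k−1)a(k)x^k)` is a chain of arches each marking a gap, `H_j` marks `j` gaps of one arch.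
EVIDENCE (all exact): brute-force switch statistics on the `a(m)` connected diagrams for `m ≤ 9` (three faces of L4b agree), a direct enumeration
of one-defect self-avoiding words for `m ≤ 9` (P22c, HIT), and the six sub-leading coefficients `A'_2..A'_7` of the lane's polygon polynomials;
`Pa`, `Ne` also satisfy the root-decomposition functional equations through all chord diagrams.  PREDICTED (P22, zero tolerance, open):
`b(10) = 6 899 770 620`, `b(11) = 187 006 205 826`, `fullClosingCount 7 16 = 7 334 506 045 440`, `[σ⁷] 2·16·p_16 = −21 886 892`,
`p_16(ℤ⁷) = 1 184 691 509 778`, `c_8 = 1412710/593859`.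

PROVED HERE: the values `b(2..8)` of the closed form (`oneDefect_values`, by `decide`) and **the law at `m = 2, 3, 4, 5`**
(`polygonSubleadingCoeff_two/three/four/five`) from the exact polygon polynomials of the tree.  NOT proved here: L4a (all `m`; in preparation as
the analogue of …PcintClosingWordCount) and L4c (the forest decomposition).

HONEST FRAMING: a typed structure law with its first instances; nothing here is used by a certified `p_c` cell.  No `sorry`; standard axioms.
Written by prim-pcint-2 gen 21 (prover-prim-pcint-2-g21-0), 2026-08-27.
-/

noncomputable section

open Filter Topology
open Literature.Probability.LatticeModels Literature.Probability.Percolation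
open Summit.CriticalPhenomena.PercolationContinuityZ3.Theorems.Pcint
open Summit.CriticalPhenomena.PercolationContinuityZ3.Theorems.Pcint.PolyCert

namespace Summit.CriticalPhenomena.PercolationContinuityZ3.Theorems.Pcint.MemoryTail

variable {d : ℕ}

/-! ### The closed form -/

/-- Cauchy product of two integer coefficient sequences: `(f ⋆ g)(n) = Σ_{i+j=n} f i · g j`. [folklore] -/
def conv (f g : ℕ → ℤ) (n : ℕ) : ℤ := ∑ p ∈ Finset.antidiagonal n, f p.1 * g p.2

/-- `U(x) = A(x)/x = Σ a(i+1) x^i` (`= 1/(1 − Σ (2k−1)a(k)x^k)`, the chain-of-arches series). [folklore] -/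
def cU (i : ℕ) : ℤ := connChord (i + 1)

/-- `A'(x) = Σ (i+1)·a(i+1)·x^i`. [folklore] -/
def cA' (i : ℕ) : ℤ := (i + 1) * connChord (i + 1)

/-- `H₃(x) = Σ C(2i−1, 3)·a(i)·x^i` (an arch with three marked gaps). [folklore] -/
def cH3 (i : ℕ) : ℤ := (2 * i - 1).choose 3 * connChord i

/-- `H₄(x) = Σ C(2i−1, 4)·a(i)·x^i` (an arch with four marked gaps). [folklore] -/
def cH4 (i : ℕ) : ℤ := (2 * i - 1).choose 4 * connChord i

/-- The one-defect series `5·A'³ + U³·A'·(9H₃ − 7) + U⁴·(3H₄ + 2)` (coefficient of `x^n`).  STRUCTURE CONJ closed form (prim-pcint-2 gen 21). -/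
def oneDefectGF (n : ℕ) : ℤ :=
  5 * conv cA' (conv cA' cA') n + 9 * conv (conv cU (conv cU cU)) (conv cA' cH3) n - 7 * conv (conv cU (conv cU cU)) cA' n +
    3 * conv (conv cU (conv cU (conv cU cU))) cH4 n + 2 * conv cU (conv cU (conv cU cU)) n

/-- **`b(m)`**, the one-defect number (closed form): `b(m) = [x^{m−2}] (5A'³ + U³A'(9H₃ − 7) + U⁴(3H₄ + 2))` for `m ≥ 2`.
STRUCTURE CONJ (prim-pcint-2 gen 21): equals the number of edges of the switch graph on connected chord diagrams with `m` chords. -/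
def oneDefect (m : ℕ) : ℤ := oneDefectGF (m - 2)

/-- **`A'_m = b(m) − m(m−1)·a(m)`**, the predicted sub-leading coefficient `[σ^{m−1}] 2·2m·p_2m(ℤ^d)`. STRUCTURE CONJ (prim-pcint-2 gen 21). -/
def subleadingCoeff (m : ℕ) : ℤ := oneDefect m - m * (m - 1) * connChord m

/-- The first values of the closed form: `b(2..8) = 0, 3, 62, 1205, 24105, 507892, 11369212` (= the brute-force switch-graph edge counts and
the one-defect word counts, P22c). [folklore] -/
theorem oneDefect_values :
    oneDefect 2 = 0 ∧ oneDefect 3 = 3 ∧ oneDefect 4 = 62 ∧ oneDefect 5 = 1205 ∧ oneDefect 6 = 24105 ∧ oneDefect 7 = 507892 ∧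
      oneDefect 8 = 11369212 := by
  decide

/-- The predicted sub-leading coefficients `A'_2..A'_8 = −2, −21, −262, −3755, −60795, −1097852, −21886892` (the first six are the lane's
exact polygon polynomials; the seventh is prediction P22d). [folklore] -/
theorem subleadingCoeff_values :
    subleadingCoeff 2 = -2 ∧ subleadingCoeff 3 = -21 ∧ subleadingCoeff 4 = -262 ∧ subleadingCoeff 5 = -3755 ∧
      subleadingCoeff 6 = -60795 ∧ subleadingCoeff 7 = -1097852 ∧ subleadingCoeff 8 = -21886892 := by
  decide

/-! ### The typed law -/

/-- **L4 (STRUCTURE P22): the SUB-LEADING coefficient of the rooted oriented `2m`-gon count of `ℤ^d` is the one-defect number minus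
`m(m−1)a(m)`**: `(closingCount d (2m) − a(m)·(2d)^m)/(2d)^{m−1} → b(m) − m(m−1)·a(m)` as `d → ∞`, for every `m ≥ 2`, with `b` the closed
form `oneDefect`.  Proved below for `m ≤ 5`; the values `m = 6, 7` agree with the lane's `closingCount d 12`, `closingCount d 14`
(kit polynomials, not in the tree).  STRUCTURE CONJ (prim-pcint-2 gen 21, 2026-08-27; not kernel-checked beyond `m = 5`). -/
@[conjecture] def polygonSubleadingCoeffLaw : Prop :=
  ∀ m : ℕ, 2 ≤ m → Tendsto (fun d : ℕ => ((closingCount d (2 * m) : ℝ) - (connChord m : ℝ) * (2 * (d : ℝ)) ^ m) / (2 * (d : ℝ)) ^ (m - 1))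
    atTop (𝓝 ((subleadingCoeff m : ℤ) : ℝ))

/-! ### The law at the first four rungs (theorems) -/

/-- **L4 at `m = 2`**: `(2d(2d−2) − (2d)²)/(2d) = −2 = b(2) − 2·a(2)`. [folklore] -/
theorem polygonSubleadingCoeff_two :
    Tendsto (fun d : ℕ => ((closingCount d (2 * 2) : ℝ) - (connChord 2 : ℝ) * (2 * (d : ℝ)) ^ 2) / (2 * (d : ℝ)) ^ (2 - 1))
      atTop (𝓝 ((subleadingCoeff 2 : ℤ) : ℝ)) := by
  rw [subleadingCoeff_values.1, connChord_values.2.1]; push_cast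
  refine tendsto_of_abs_le_div (C := 0) 1 fun d hd => ?_
  have hd' : (1 : ℝ) ≤ d := by exact_mod_cast hd
  have hd0 : (0 : ℝ) < d := by linarith
  have hc : (closingCount d (2 * 2) : ℝ) = 2 * d * (2 * d - 2) := by
    rw [closingCount_four_eq]; push_cast [Nat.cast_sub (show 2 ≤ 2 * d by omega)]; ring
  have hval : ((closingCount d (2 * 2) : ℝ) - 1 * (2 * (d : ℝ)) ^ 2) / (2 * (d : ℝ)) ^ (2 - 1) = -2 := by
    rw [hc, show (2 : ℕ) - 1 = 1 from rfl, pow_one]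
    field_simp
    ring
  rw [hval, zero_div]
  constructor <;> linarith

/-- **L4 at `m = 3`**: `(32d³ − 84d² + 52d − 4·(2d)³)/(2d)² = −21 + 13/d → −21 = b(3) − 6·a(3)`. [folklore] -/
theorem polygonSubleadingCoeff_three :
    Tendsto (fun d : ℕ => ((closingCount d (2 * 3) : ℝ) - (connChord 3 : ℝ) * (2 * (d : ℝ)) ^ 3) / (2 * (d : ℝ)) ^ (3 - 1))
      atTop (𝓝 ((subleadingCoeff 3 : ℤ) : ℝ)) := by
  rw [subleadingCoeff_values.2.1, connChord_values.2.2.1]; push_cast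
  refine tendsto_of_abs_le_div (C := 13) 4 fun d hd => ?_
  have hd' : (4 : ℝ) ≤ d := by exact_mod_cast hd
  have hd0 : (0 : ℝ) < d := by linarith
  have hval : ((closingCount d (2 * 3) : ℝ) - 4 * (2 * (d : ℝ)) ^ 3) / (2 * (d : ℝ)) ^ (3 - 1) = -21 + 13 / d := by
    rw [show 2 * 3 = 6 from rfl, closingCount_six_eq_real hd, show (3 : ℕ) - 1 = 2 from rfl]
    field_simp
    ring
  rw [hval]
  have h13 : (0 : ℝ) ≤ 13 / d := by positivity
  constructor <;> linarith

/-- **L4 at `m = 4`**: `(432d⁴ − 2096d³ + 3320d² − 1656d − 27·(2d)⁴)/(2d)³ → −262 = b(4) − 12·a(4)`. [folklore] -/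
theorem polygonSubleadingCoeff_four :
    Tendsto (fun d : ℕ => ((closingCount d (2 * 4) : ℝ) - (connChord 4 : ℝ) * (2 * (d : ℝ)) ^ 4) / (2 * (d : ℝ)) ^ (4 - 1))
      atTop (𝓝 ((subleadingCoeff 4 : ℤ) : ℝ)) := by
  rw [subleadingCoeff_values.2.2.1, connChord_values.2.2.2.1]; push_cast
  refine tendsto_of_abs_le_div (C := 415) 5 fun d hd => ?_
  have hd' : (5 : ℝ) ≤ d := by exact_mod_cast hd
  have hd0 : (0 : ℝ) < d := by linarith
  have hval : ((closingCount d (2 * 4) : ℝ) - 27 * (2 * (d : ℝ)) ^ 4) / (2 * (d : ℝ)) ^ (4 - 1) = -262 + 415 / d - 207 / d ^ 2 := by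
    rw [show 2 * 4 = 8 from rfl, closingCount_eight_eq_real hd, show (4 : ℕ) - 1 = 3 from rfl]
    field_simp
    ring
  rw [hval]
  have h1 : (0 : ℝ) ≤ 207 / d ^ 2 := by positivity
  have h2 : (207 : ℝ) / d ^ 2 ≤ 415 / d := by
    rw [div_le_div_iff₀ (by positivity) hd0]
    nlinarith
  have h3 : (0 : ℝ) ≤ 415 / d := by positivity
  constructor <;> linarith

/-- **L4 at `m = 5`**: `(7936d⁵ − 60080d⁴ + … − 248·(2d)⁵)/(2d)⁴ → −3755 = b(5) − 20·a(5)`. [folklore] -/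
theorem polygonSubleadingCoeff_five :
    Tendsto (fun d : ℕ => ((closingCount d (2 * 5) : ℝ) - (connChord 5 : ℝ) * (2 * (d : ℝ)) ^ 5) / (2 * (d : ℝ)) ^ (5 - 1))
      atTop (𝓝 ((subleadingCoeff 5 : ℤ) : ℝ)) := by
  rw [subleadingCoeff_values.2.2.2.1, connChord_values.2.2.2.2.1]; push_cast
  refine tendsto_of_abs_le_div (C := 30000) 6 fun d hd => ?_
  have hd' : (6 : ℝ) ≤ d := by exact_mod_cast hd
  have hd0 : (0 : ℝ) < d := by linarith
  have hval : ((closingCount d (2 * 5) : ℝ) - 248 * (2 * (d : ℝ)) ^ 5) / (2 * (d : ℝ)) ^ (5 - 1) =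
      -3755 + (10615 / d - 25965 / (2 * d ^ 2) + 11253 / (2 * d ^ 3)) := by
    rw [show 2 * 5 = 10 from rfl, closingCount_ten_eq_real hd, show (5 : ℕ) - 1 = 4 from rfl]
    field_simp
    ring
  rw [hval]
  have hd1 : (1 : ℝ) ≤ d := by linarith
  have e1 : (10615 : ℝ) / d ≤ 30000 / d := by gcongr; norm_num
  have e1' : (0 : ℝ) ≤ 10615 / d := by positivity
  have e2 : (25965 : ℝ) / (2 * d ^ 2) ≤ 13000 / d := by
    rw [div_le_div_iff₀ (by positivity) hd0]; nlinarith
  have e2' : (0 : ℝ) ≤ 25965 / (2 * d ^ 2) := by positivity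
  have e3 : (11253 : ℝ) / (2 * d ^ 3) ≤ 6000 / d := by
    rw [div_le_div_iff₀ (by positivity) hd0]
    have : (0:ℝ) ≤ d ^ 2 := by positivity
    nlinarith
  have e3' : (0 : ℝ) ≤ 11253 / (2 * d ^ 3) := by positivity
  have s1 : (10615 : ℝ) / d + 6000 / d ≤ 30000 / d := by
    rw [← add_div]; gcongr; norm_num
  have s2 : (13000 : ℝ) / d ≤ 30000 / d := by gcongr; norm_num
  constructor <;> linarith

/-- **L4 holds at every rung `2 ≤ m ≤ 5`.** [folklore] -/
theorem polygonSubleadingCoeffLaw_of_le_five (m : ℕ) (hm : 2 ≤ m) (hm5 : m ≤ 5) :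
    Tendsto (fun d : ℕ => ((closingCount d (2 * m) : ℝ) - (connChord m : ℝ) * (2 * (d : ℝ)) ^ m) / (2 * (d : ℝ)) ^ (m - 1))
      atTop (𝓝 ((subleadingCoeff m : ℤ) : ℝ)) := by
  interval_cases m
  · exact polygonSubleadingCoeff_two
  · exact polygonSubleadingCoeff_three
  · exact polygonSubleadingCoeff_four
  · exact polygonSubleadingCoeff_five

end Summit.CriticalPhenomena.PercolationContinuityZ3.Theorems.Pcint.MemoryTail
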